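import Literature.AlgebraicGeometry.Resolution.EmbeddedResolutionExcellentSurfacesHistory
import Literature.AlgebraicGeometry.Resolution.ExceptionalPointsFinite
import Literature.AlgebraicGeometry.Resolution.GermsOfClosedSubsets
import HarnessLib

/-!
# Chain W5.2 — F6 stage 1, residual `LegalDivisorReduction₃`: presenting a boundary to the Cossart–Jannsen–Saito history fact F-72
# (irreducible components of a closed set as pairwise-distinct `ℕ`-labelled members; the start history `O = 𝓑(·)`)

[OURS · L1 W5.2 · res-D-pv-016 AS res-L1-w52-stub-5, entry bookkeeping for the F-72 corollaries (K-b) `oldBoundaryResolution₃_of_F72`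
(`…DepthFlagLegalOldBoundaryOfF72`) and (K-conn) (res-type-049).]  NOT statements of the manuscript under review; AI-written, weaker
than expert review; fact-free (pure topology / bookkeeping over res-lit-6's `CJSHistory` vocabulary, p533571).

* `closure_singleton_mem_irreducibleComponentsOf`, `exists_componentLabelling` — the hypotheses «`B_j ∈ irreducibleComponentsOf Z (⋃B)`
  for `j < k`, `Set.InjOn B (Iio k)`, `B_j = ∅` for `j ≥ k`» of `CossartJannsenSaito2020_canonicalSequence_history` for an arbitrary
  closed subset of a Noetherian scheme (members = closures of the finitely many maximal points, `maxPoints_finite`);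
* `boundaryAt_eq_inter_of_empty`, `biUnion_lt_eq_iUnion_of_empty` — with members empty beyond the counter, `𝓑(x) = {j < k | x ∈ B_j}`
  and `⋃_{j<k} B_j = ⋃_j B_j`.
[cite: CossartJannsenSaito2020, (4.1) p. 54 (boundaries ↔ s.n.c. divisors), Def. 4.4 (b)] [cite: StacksProject, Tag 004W]
-/

-- `Summit.<Summit>.<Sub>.Theorems` with `Sub = Summit` (single-conjunct summit, D-0017)
set_option linter.dupNamespace false

noncomputable section

open CategoryTheory CategoryTheory.Limits AlgebraicGeometry TopologicalSpace
open Literature.AlgebraicGeometry.Resolution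

namespace Summit.ResolutionOfSingularities.ResolutionOfSingularities.Theorems.DepthLegal

universe u

/-! ## §1 Labelling the components of a closed set -/

/-- The closure of a maximal point of a closed set is one of its irreducible components (res-lit-6's
`CJSHistory.irreducibleComponentsOf`). [folklore] -/
theorem closure_singleton_mem_irreducibleComponentsOf {Z : Scheme.{u}} {S : Set Z} (hS : IsClosed S) {η : Z}
    (hη : η ∈ maxPoints S) : closure ({η} : Set Z) ∈ CJSHistory.irreducibleComponentsOf Z S := by
  have hηS : η ∈ S := maxPoints_subset S hη
  refine ⟨⟨isIrreducible_singleton.closure, closure_minimal (Set.singleton_subset_iff.mpr hηS) hS⟩, ?_⟩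
  rintro T ⟨hTirr, hTS⟩ hηT
  have hgen : IsGenericPoint hTirr.genericPoint (closure T) := hTirr.isGenericPoint_genericPoint_closure
  have hζS : hTirr.genericPoint ∈ S := (closure_minimal hTS hS) hgen.mem
  have hζη : hTirr.genericPoint ⤳ η := hgen.specializes (subset_closure (hηT (subset_closure rfl)))
  have heq : hTirr.genericPoint = η := hη.2 _ hζS hζη
  calc T ⊆ closure T := subset_closure
    _ = closure {η} := by rw [← hgen.def, heq]

/-- **Labelling the irreducible components of a closed subset of a Noetherian scheme by `ℕ`**: pairwise distinct members
`B 0, …, B (k-1)`, each an irreducible component, empty beyond `k`, all closed, with union `S`. [folklore] -/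
theorem exists_componentLabelling {Z : Scheme.{u}} [IsNoetherian Z] {S : Set Z} (hS : IsClosed S) :
    ∃ (B : ℕ → Set Z) (k : ℕ), (⋃ j, B j) = S ∧ (∀ j, k ≤ j → B j = ∅) ∧
      (∀ j < k, B j ∈ CJSHistory.irreducibleComponentsOf Z S) ∧ Set.InjOn B (Set.Iio k) ∧ (∀ j, IsClosed (B j)) := by
  classical
  have hfin : (maxPoints S).Finite := maxPoints_finite hS
  set L : List Z := hfin.toFinset.toList with hL
  have hLnd : L.Nodup := hfin.toFinset.nodup_toList
  have hmemL : ∀ η, η ∈ L ↔ η ∈ maxPoints S := fun η => by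
    rw [hL, Finset.mem_toList, Set.Finite.mem_toFinset]
  set k := L.length with hk
  set B : ℕ → Set Z := fun j => if h : j < k then closure {L[j]} else ∅ with hB
  have hBlt : ∀ {j} (h : j < k), B j = closure {L[j]} := fun h => by simp [hB, h]
  have hBge : ∀ j, k ≤ j → B j = ∅ := fun j hj => by simp [hB, not_lt.mpr hj]
  refine ⟨B, k, ?_, hBge, ?_, ?_, ?_⟩
  · apply le_antisymm
    · refine Set.iUnion_subset fun j => ?_
      by_cases hj : j < k
      · rw [hBlt hj]
        exact closure_minimal (Set.singleton_subset_iff.mpr (maxPoints_subset S ((hmemL _).mp (List.getElem_mem hj))))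
          hS
      · rw [hBge j (not_lt.mp hj)]; exact Set.empty_subset _
    · intro w hw
      obtain ⟨η, hη, hηw⟩ := exists_mem_maxPoints_specializes hS hw
      obtain ⟨j, hj, hjη⟩ := List.getElem_of_mem ((hmemL η).mpr hη)
      refine Set.mem_iUnion.mpr ⟨j, ?_⟩
      rw [hBlt hj, hjη]
      exact hηw.mem_closure
  · intro j hj
    rw [hBlt hj]
    exact closure_singleton_mem_irreducibleComponentsOf hS ((hmemL _).mp (List.getElem_mem hj))
  · intro j₁ hj₁ j₂ hj₂ heq
    have hj₁' : j₁ < k := Set.mem_Iio.mp hj₁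
    have hj₂' : j₂ < k := Set.mem_Iio.mp hj₂
    rw [hBlt hj₁', hBlt hj₂'] at heq
    have hgen₁ : IsGenericPoint L[j₁] (closure ({L[j₁]} : Set Z)) := isGenericPoint_closure
    have hgen₂ : IsGenericPoint L[j₂] (closure ({L[j₂]} : Set Z)) := isGenericPoint_closure
    have hpt : L[j₁] = L[j₂] := by
      rw [heq] at hgen₁
      exact hgen₁.eq hgen₂
    exact (List.Nodup.getElem_inj_iff hLnd).mp hpt
  · intro j
    by_cases hj : j < k
    · rw [hBlt hj]; exact isClosed_closure
    · rw [hBge j (not_lt.mp hj)]; exact isClosed_empty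

/-! ## §2 The start history and the old-label union -/

/-- The history of the START, `O = 𝓑(·)`, is «the old labels through the point» (members beyond the counter are empty). [folklore] -/
theorem boundaryAt_eq_inter_of_empty {Z : Scheme.{u}} {B : ℕ → Set Z} {k : ℕ} (hB : ∀ j, k ≤ j → B j = ∅) (x : Z) :
    BoundaryHistory.boundaryAt B x = Set.Iio k ∩ BoundaryHistory.boundaryAt B x := by
  ext j
  simp only [BoundaryHistory.boundaryAt, Set.mem_setOf_eq, Set.mem_inter_iff, Set.mem_Iio]
  constructor
  · intro hj
    refine ⟨?_, hj⟩
    by_contra hjk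
    rw [hB j (not_lt.mp hjk)] at hj
    exact hj
  · exact fun h => h.2

/-- With members empty beyond the counter, the union over the old labels is the union over all labels. [folklore] -/
theorem biUnion_lt_eq_iUnion_of_empty {Z : Scheme.{u}} {B : ℕ → Set Z} {k : ℕ} (hB : ∀ j, k ≤ j → B j = ∅) :
    (⋃ j ∈ Set.Iio k, B j) = ⋃ j, B j := by
  apply le_antisymm
  · exact Set.iUnion₂_subset fun j _ => Set.subset_iUnion B j
  · refine Set.iUnion_subset fun j => ?_
    by_cases hj : j < k
    · exact Set.subset_biUnion_of_mem (u := fun j => B j) (Set.mem_Iio.mpr hj)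
    · rw [hB j (not_lt.mp hj)]; exact Set.empty_subset _

end Summit.ResolutionOfSingularities.ResolutionOfSingularities.Theorems.DepthLegal

end
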